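import Summits.Ventures.CertifiedManyBodySolver.Rows.SourcedTorusRowsDensityBridge
import HarnessLib

/-!
# PINNING-FIELD rows: the one-point word under affine `D₄` labels — the canonical one-point cell

HONEST FRAMING: first certified bounds on pairing observables; not a superconductivity verdict; every
number certified (two lineages + referee) or labelled float. A response AT FIXED `h > 0` is
symmetry-allowed and says nothing about spontaneous order.

WHAT THIS FILE IS (cell hubbard-cq, D-0082 (c) / LADDER row PC-a, seat hubbard-cq-obsth-1 "pinning-field K5
menu nodes"; sequel of `Rows/SourcedTorusRowsHook.lean` §3 and `Rows/SourcedTorusRowsDensityBridge.lean`). A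
symmetry-reduced one-point certificate is read in the orbit state over `(U_w D_γ)_{w ∈ (ℤ/Lℤ)², γ ∈ S}` with labels
`S ∋ 1` closed under products and `χ_{B₁g} = 1` on `S` (the quarter turn maps `h ↦ −h`), over a window
`Λ' ⊇` pair region, with objective `Γ(incl)(Φ₀ + Φ₀ᴴ)`. For the `d`-wave pair word the labels are invisible:
`(U_w D_γ)(Δ_d + Δ_dᴴ)(U_w D_γ)ᴴ = Δ_d + Δ_dᴴ` for `χ_{B₁g}(γ) = 1` (`Δ_d` translation invariant and `B₁g`,
`relabel_translate_pairField`, `relabel_d4Perm_pairField_dWave`) — `spaceGroupUnitary_conj_pairField_add_conjTranspose`,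
`orbitState_spaceGroup_pairField_add_conjTranspose` (`ω̄_ψ(Δ_d + Δ_dᴴ) = ⟨ψ, (Δ_d + Δ_dᴴ)ψ⟩`), and
`re_orbitState_spaceGroup_onePointPairWord_eq_div`: `Re ω̄_ψ(Γ(ι_{Λ',L}) Γ(incl)(Φ₀ + Φ₀ᴴ)) = Re ⟨ψ, (Δ_d + Δ_dᴴ)ψ⟩/L²`
(generalises `re_orbitState_onePointPairWord_eq_div`, `S = {1}`, window = pair region). Hence the one-point
ground-state cell over any such window and label set IS the canonical one-point cell
(`SourcedTorusCorrLowerRowGS.onePoint_canonical`, upper twin, uniform `∃ L₀` twins) — and then, by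
`Rows/SourcedTorusRowsDensityBridge`, a response leaf `PinFieldResponseFloorAt / CeilingAt`. The end-to-end
corollary for KKT one-point certificates is `Rows/SourcedTorusRowsOnePointKKT.lean`.

NOTHING IS ASSERTED: cells in, cells out; no certificate, no number, no `sorry`, no named fact. Elaborated under
the torus files' local `DecidableEq (FermionTorus 2 L)` instance (cells met literally).

References: D. J. Scalapino, Phys. Rep. 250 (1995) 329, §2 eq. (2.3); O. Bratteli, D. W. Robinson II §6.2.4;
X. Han, arXiv:2006.06002 §2–3; T. Koma, H. Tasaki, J. Stat. Phys. 76 (1994) 745, §1.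
-/

noncomputable section

namespace Summit.Ventures.CertifiedManyBodySolver

open Literature.MathematicalPhysics.QuantumLattice
open Matrix HubbardWave0 Literature.Probability.LatticeModels Finset
open Literature.MathematicalPhysics.QuantumManyBody.StateRelaxation
open Summit.Ventures.CertifiedManyBodySolver.Observables
open scoped BigOperators ComplexOrder

/-- (Local to this file, as in `Rows/SourcedTorusRows[Hook]`.) -/
local instance (priority := high) instDecidableEqFermionTorusSourcedOnePointD4 {L : ℕ} :
    DecidableEq (FermionTorus 2 L) :=
  LinearOrder.toDecidableEq

/-! ## §1  The `d`-wave pair operator and the one-point word under the labelled space group -/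

section OnePointD4

variable {L : ℕ} [NeZero L]

/-- **The Hermitian `d`-wave pair operator is invariant under the space group restricted to `ker χ_{B₁g}`**:
`(U_w D_γ)(Δ_d + Δ_dᴴ)(U_w D_γ)ᴴ = Δ_d + Δ_dᴴ` for `χ_{B₁g}(γ) = 1` (`Δ_d` is translation invariant,
`relabel_translate_pairField`, and transforms by `χ_{B₁g}` under `D₄`, `relabel_d4Perm_pairField_dWave`).
[cite: Scalapino1995, §2 eq. (2.3)] -/
theorem spaceGroupUnitary_conj_pairField_add_conjTranspose {S : Finset (DihedralGroup 4)}
    (hS : ∀ γ ∈ S, b1gChar γ = 1) (g : TorusSite 2 L × ↥S) :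
    spaceGroupUnitary S g * (pairField dWaveFormFactor L + (pairField dWaveFormFactor L)ᴴ) *
        (spaceGroupUnitary S g)ᴴ = pairField dWaveFormFactor L + (pairField dWaveFormFactor L)ᴴ := by
  obtain ⟨v, γ, hγ⟩ := g
  show (fockTranslate v).val * (fockD4 (L := L) γ).val * (pairField dWaveFormFactor L + (pairField dWaveFormFactor L)ᴴ) *
      ((fockTranslate v).val * (fockD4 (L := L) γ).val)ᴴ = _
  have hD : (fockD4 (L := L) γ).val * (pairField dWaveFormFactor L + (pairField dWaveFormFactor L)ᴴ) *
      (fockD4 (L := L) γ).valᴴ = pairField dWaveFormFactor L + (pairField dWaveFormFactor L)ᴴ := by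
    rw [fockD4_apply, ← relabel_eq_fockRelabel_conj, relabel_add, relabel_conjTranspose,
      relabel_d4Perm_pairField_dWave, hS γ hγ, one_smul]
  have hT : (fockTranslate v).val * (pairField dWaveFormFactor L + (pairField dWaveFormFactor L)ᴴ) *
      (fockTranslate v).valᴴ = pairField dWaveFormFactor L + (pairField dWaveFormFactor L)ᴴ := by
    rw [← relabel_eq_fockRelabel_conj, relabel_add, relabel_conjTranspose, relabel_translate_pairField]
  rw [conjTranspose_mul]
  calc (fockTranslate v).val * (fockD4 (L := L) γ).val * (pairField dWaveFormFactor L + (pairField dWaveFormFactor L)ᴴ) *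
        ((fockD4 (L := L) γ).valᴴ * (fockTranslate v).valᴴ)
      = (fockTranslate v).val * ((fockD4 (L := L) γ).val * (pairField dWaveFormFactor L + (pairField dWaveFormFactor L)ᴴ) *
          (fockD4 (L := L) γ).valᴴ) * (fockTranslate v).valᴴ := by
        simp only [Matrix.mul_assoc]
    _ = pairField dWaveFormFactor L + (pairField dWaveFormFactor L)ᴴ := by rw [hD, hT]

/-- **The orbit state over `(U_w D_γ)_{w, γ ∈ S}` of `Δ_d + Δ_dᴴ` is the plain expectation**:
`ω̄_ψ(Δ_d + Δ_dᴴ) = ⟨ψ, (Δ_d + Δ_dᴴ) ψ⟩` for `S ⊆ ker χ_{B₁g}` nonempty (each orbit vector `(U_w D_γ)ᴴ ψ` gives the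
same expectation). [cite: BratteliRobinsonII1997, §6.2.4] -/
theorem orbitState_spaceGroup_pairField_add_conjTranspose {S : Finset (DihedralGroup 4)} (hne : S.Nonempty)
    (hS : ∀ γ ∈ S, b1gChar γ = 1) (ψ : Fock (Orb (FermionTorus 2 L))) :
    orbitState (spaceGroupUnitary S) ψ (pairField dWaveFormFactor L + (pairField dWaveFormFactor L)ᴴ) =
      star ψ ⬝ᵥ (pairField dWaveFormFactor L + (pairField dWaveFormFactor L)ᴴ) *ᵥ ψ := by
  haveI : Nonempty ↥S := hne.coe_sort
  set Op := pairField dWaveFormFactor L + (pairField dWaveFormFactor L)ᴴ with hOp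
  have hg : ∀ g : TorusSite 2 L × ↥S,
      Literature.MathematicalPhysics.QuantumManyBody.StateRelaxation.vectorState ((spaceGroupUnitary S g)ᴴ *ᵥ ψ) Op =
        star ψ ⬝ᵥ Op *ᵥ ψ := by
    intro g
    have hTT' : (spaceGroupUnitary S g)ᴴ * spaceGroupUnitary S g = 1 := d4Affine_conjTranspose_mul_self _ _
    have hTT : spaceGroupUnitary S g * (spaceGroupUnitary S g)ᴴ = 1 := mul_eq_one_comm.mp hTT'
    have hcomm : spaceGroupUnitary S g * Op = Op * spaceGroupUnitary S g := by
      have h := congrArg (· * spaceGroupUnitary S g) (spaceGroupUnitary_conj_pairField_add_conjTranspose (L := L) hS g)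
      rw [Matrix.mul_assoc, hTT', Matrix.mul_one] at h
      exact h
    rw [Literature.MathematicalPhysics.QuantumManyBody.StateRelaxation.vectorState_apply, star_mulVec,
      conjTranspose_conjTranspose, ← dotProduct_mulVec, mulVec_mulVec, mulVec_mulVec, hcomm,
      Matrix.mul_assoc, hTT, Matrix.mul_one]
  rw [orbitState_apply]
  simp_rw [hg]
  rw [Finset.sum_const, Finset.card_univ, nsmul_eq_mul, ← mul_assoc,
    inv_mul_cancel₀ (Nat.cast_ne_zero.mpr Fintype.card_ne_zero), one_mul]

/-- **The orbit state of the pulled-back one-point word does not see the labels**: for `S ∋ 1` closed under products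
with `χ_{B₁g} = 1` on `S`, every window `Λ' ⊇` pair region and every vector `ψ`,
`Re ω̄_ψ(Γ(ι_{Λ',L}) Γ(incl)(Φ₀ + Φ₀ᴴ)) = Re ⟨ψ, (Δ_d + Δ_dᴴ) ψ⟩ / L²` (translations of the orbit family average the
word to `(Δ_d + Δ_dᴴ)/L²`, `orbitState_sum_conj`; `Σ_w U_w Γ(Φ₀ + Φ₀ᴴ) U_wᴴ = Δ_d + Δ_dᴴ`). Generalises
`re_orbitState_onePointPairWord_eq_div` (`S = {1}`, window = pair region). [cite: BratteliRobinsonII1997, §6.2.4] -/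
theorem re_orbitState_spaceGroup_onePointPairWord_eq_div {S : Finset (DihedralGroup 4)} (h1 : (1 : DihedralGroup 4) ∈ S)
    (hmul : ∀ a ∈ S, ∀ b ∈ S, a * b ∈ S) (hS : ∀ γ ∈ S, b1gChar γ = 1)
    {Λ' : Finset (Site 2)} (hP : pairRegion (insert (0 : Site 2) unitSteps) 0 ⊆ Λ')
    (hInj' : Set.InjOn (Torus.proj (d := 2) L) ↑Λ') (ψ : Fock (Orb (FermionTorus 2 L))) :
    (orbitState (spaceGroupUnitary S) ψ
        (fermionEmbed (PolySite.toTorusEmb L hInj') (fermionEmbed (PolySite.incl hP) onePointPairWord))).re =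
      (star ψ ⬝ᵥ ((pairField dWaveFormFactor L + (pairField dWaveFormFactor L)ᴴ) *ᵥ ψ)).re / (L : ℝ) ^ 2 := by
  haveI : Nonempty ↥S := ⟨⟨1, h1⟩⟩
  have hInjP : Set.InjOn (Torus.proj (d := 2) L) ↑(pairRegion (insert (0 : Site 2) unitSteps) 0) :=
    hInj'.mono (by exact_mod_cast hP)
  have hLr : ((L : ℝ)) ^ 2 ≠ 0 := pow_ne_zero 2 (Nat.cast_ne_zero.2 (NeZero.ne L))
  -- the composite pull-back is the pull-back from the pair region
  have hcomp : fermionEmbed (PolySite.toTorusEmb L hInj') (fermionEmbed (PolySite.incl hP) onePointPairWord) =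
      fermionEmbed (PolySite.toTorusEmb L hInjP) onePointPairWord := by
    rw [fermionEmbed_fermionEmbed]
    exact congrFun (congrArg DFunLike.coe (fermionEmbed_congr fun p => rfl)) _
  -- the translations of the orbit family average the word to `(Δ_d + Δ_dᴴ)/L²`
  have hT' : ∀ v' : TorusSite 2 L, ∃ σ : (TorusSite 2 L × ↥S) ≃ (TorusSite 2 L × ↥S), ∀ g,
      spaceGroupUnitary S g * (fockTranslate v').val = spaceGroupUnitary S (σ g) :=
    fun v' => spaceGroupUnitary_closed_translate h1 hmul v'
  have havg := orbitState_sum_conj (spaceGroupUnitary S) ψ (fun v' : TorusSite 2 L => (fockTranslate v').val) hT'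
    (fermionEmbed (PolySite.toTorusEmb L hInjP) onePointPairWord)
  rw [sum_conj_fockTranslate_fermionEmbed_onePointPairWord hInjP,
    orbitState_spaceGroup_pairField_add_conjTranspose ⟨1, h1⟩ hS ψ, card_torusSite] at havg
  -- solve for the orbit state of the word
  have hc : ((L ^ 2 : ℕ) : ℂ) = ((((L : ℝ)) ^ 2 : ℝ) : ℂ) := by push_cast; ring
  have hne : ((L ^ 2 : ℕ) : ℂ) ≠ 0 := by rw [hc]; exact_mod_cast hLr
  have hsolve : orbitState (spaceGroupUnitary S) ψ (fermionEmbed (PolySite.toTorusEmb L hInjP) onePointPairWord) =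
      ((((L : ℝ)) ^ 2 : ℝ) : ℂ)⁻¹ *
        (star ψ ⬝ᵥ (pairField dWaveFormFactor L + (pairField dWaveFormFactor L)ᴴ) *ᵥ ψ) := by
    rw [← hc, eq_inv_mul_iff_mul_eq₀ hne]
    exact havg.symm
  rw [hcomp, hsolve, ← Complex.ofReal_inv, Complex.re_ofReal_mul, inv_mul_eq_div]

variable {tp U μ h : ℝ} {r : ℚ}

/-- **The one-point LOWER ground-state cell over any window and any admissible label set IS the canonical one-point
cell** (`S = {1}`, window = pair region): for `S ∋ 1` closed under products with `χ_{B₁g} = 1` on `S`. -/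
theorem SourcedTorusCorrLowerRowGS.onePoint_canonical {S : Finset (DihedralGroup 4)} (h1 : (1 : DihedralGroup 4) ∈ S)
    (hmul : ∀ a ∈ S, ∀ b ∈ S, a * b ∈ S) (hS : ∀ γ ∈ S, b1gChar γ = 1)
    {Λ' : Finset (Site 2)} (hP : pairRegion (insert (0 : Site 2) unitSteps) 0 ⊆ Λ')
    (hInj' : Set.InjOn (Torus.proj (d := 2) L) ↑Λ')
    (hInjP : Set.InjOn (Torus.proj (d := 2) L) ↑(pairRegion (insert (0 : Site 2) unitSteps) 0))
    (hrow : SourcedTorusCorrLowerRowGS L tp U μ h r Λ' hInj' S (fermionEmbed (PolySite.incl hP) onePointPairWord)) :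
    SourcedTorusCorrLowerRowGS L tp U μ h r _ hInjP ({1} : Finset (DihedralGroup 4)) onePointPairWord := by
  intro M ψ hψK hψ1 hgs
  have hb := hrow M ψ hψK hψ1 hgs
  rw [re_orbitState_spaceGroup_onePointPairWord_eq_div h1 hmul hS hP hInj' ψ] at hb
  rw [re_orbitState_onePointPairWord_eq_div ψ hInjP]
  exact hb

/-- Upper twin of `SourcedTorusCorrLowerRowGS.onePoint_canonical`. -/
theorem SourcedTorusCorrUpperRowGS.onePoint_canonical {S : Finset (DihedralGroup 4)} (h1 : (1 : DihedralGroup 4) ∈ S)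
    (hmul : ∀ a ∈ S, ∀ b ∈ S, a * b ∈ S) (hS : ∀ γ ∈ S, b1gChar γ = 1)
    {Λ' : Finset (Site 2)} (hP : pairRegion (insert (0 : Site 2) unitSteps) 0 ⊆ Λ')
    (hInj' : Set.InjOn (Torus.proj (d := 2) L) ↑Λ')
    (hInjP : Set.InjOn (Torus.proj (d := 2) L) ↑(pairRegion (insert (0 : Site 2) unitSteps) 0))
    (hrow : SourcedTorusCorrUpperRowGS L tp U μ h r Λ' hInj' S (fermionEmbed (PolySite.incl hP) onePointPairWord)) :
    SourcedTorusCorrUpperRowGS L tp U μ h r _ hInjP ({1} : Finset (DihedralGroup 4)) onePointPairWord := by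
  intro M ψ hψK hψ1 hgs
  have hb := hrow M ψ hψK hψ1 hgs
  rw [re_orbitState_spaceGroup_onePointPairWord_eq_div h1 hmul hS hP hInj' ψ] at hb
  rw [re_orbitState_onePointPairWord_eq_div ψ hInjP]
  exact hb

/-- **Uniform canonical form**: `SourcedCorrLowerRowGS tp U μ h q L₀ r Λ' S (Γ(incl) (Φ₀ + Φ₀ᴴ))` gives the
canonical uniform one-point cell with threshold `max L₀ L₁` (`L₁` from `exists_forall_le_injOn_proj Λ'`). -/
theorem SourcedCorrLowerRowGS.onePoint_canonical {S : Finset (DihedralGroup 4)} (h1 : (1 : DihedralGroup 4) ∈ S)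
    (hmul : ∀ a ∈ S, ∀ b ∈ S, a * b ∈ S) (hS : ∀ γ ∈ S, b1gChar γ = 1)
    {Λ' : Finset (Site 2)} (hP : pairRegion (insert (0 : Site 2) unitSteps) 0 ⊆ Λ') {q L₀ : ℕ}
    (hrow : SourcedCorrLowerRowGS tp U μ h q L₀ r Λ' S (fermionEmbed (PolySite.incl hP) onePointPairWord)) :
    ∃ L₀' : ℕ, SourcedCorrLowerRowGS tp U μ h q L₀' r (pairRegion (insert (0 : Site 2) unitSteps) 0)
      ({1} : Finset (DihedralGroup 4)) onePointPairWord := by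
  obtain ⟨L₁, hL₁⟩ := exists_forall_le_injOn_proj Λ'
  refine ⟨max L₀ L₁, fun L _ hInjP hL hqL => ?_⟩
  exact (hrow L (hL₁ L (le_trans (le_max_right _ _) hL)) (le_trans (le_max_left _ _) hL) hqL).onePoint_canonical
    h1 hmul hS hP _ hInjP

/-- Upper twin of `SourcedCorrLowerRowGS.onePoint_canonical`. -/
theorem SourcedCorrUpperRowGS.onePoint_canonical {S : Finset (DihedralGroup 4)} (h1 : (1 : DihedralGroup 4) ∈ S)
    (hmul : ∀ a ∈ S, ∀ b ∈ S, a * b ∈ S) (hS : ∀ γ ∈ S, b1gChar γ = 1)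
    {Λ' : Finset (Site 2)} (hP : pairRegion (insert (0 : Site 2) unitSteps) 0 ⊆ Λ') {q L₀ : ℕ}
    (hrow : SourcedCorrUpperRowGS tp U μ h q L₀ r Λ' S (fermionEmbed (PolySite.incl hP) onePointPairWord)) :
    ∃ L₀' : ℕ, SourcedCorrUpperRowGS tp U μ h q L₀' r (pairRegion (insert (0 : Site 2) unitSteps) 0)
      ({1} : Finset (DihedralGroup 4)) onePointPairWord := by
  obtain ⟨L₁, hL₁⟩ := exists_forall_le_injOn_proj Λ'
  refine ⟨max L₀ L₁, fun L _ hInjP hL hqL => ?_⟩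
  exact (hrow L (hL₁ L (le_trans (le_max_right _ _) hL)) (le_trans (le_max_left _ _) hL) hqL).onePoint_canonical
    h1 hmul hS hP _ hInjP

end OnePointD4

end Summit.Ventures.CertifiedManyBodySolver

end
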